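import Mathlib
import Literature.Analysis.FluidPDE.Tao2016AveragedNS.ShiftSetCascadeFlows
import Literature.Analysis.FluidPDE.Tao2016AveragedNS.ShiftSetCascadeFlux
import Summits.NavierStokesRegularity.NavierStokesRegularity.Theorems.TaoLadderRungTwoFlatCertificateGlueCheckerSectionOn
import Summits.NavierStokesRegularity.NavierStokesRegularity.Theorems.TaoLadderRungTwoFlatCertificateGlueCheckerBranchVectorOn
import HarnessLib

/-!
# Certificate glue on a shift set `𝕊`, XXXI-b / XXXIII-b: READOUT ALONG TRAJECTORIES IN THE VECTOR LAYOUT — `StepRead` into the section-node box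
  from a step whose node carries a remainder VECTOR (`PInParaV`), and its Boolean form over the records `VRec` (helper for items
  stmt-NavierStokesRegularity-22987 `FlatGapCertificatesV2` (crux K_A♭ of route TaoLadderRungTwoFlat) and stmt-24295 K_A₂(64); cell harvest/h2-tao-ladder,
  p1 g16; theory-1 F-35 «stepRead_of_checks reads the SCALAR E₀ — tables carry E*(scalar) and E*(E0v)»)

`stepRead_of_sectionNodeV` = glue XXXI `stepRead_of_sectionNode` with the node `PInParaV x̄ C r E` and the section error `secErr q p κ E Φ Δ qmax`
taken with the remainder VECTOR `E` (glue XXX `sectionNode_box` is already stated for a vector). `stepRead_of_checksV` = glue XXXIII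
`stepRead_of_checks` over `checkStepV` (glue XXIX-c) and `checkSection` (glue XXXIII, unchanged: section point / direction / bounds against the
record's box `lo, hi` and input defect `δ`).

HONEST FRAMING: Tao-type MODEL lattices (Tao 2016 §4/§6 vocabulary, shift-set parametrised); glue lemmas and checker soundness — NO certificate
instance exists in the tree, nothing is certified here, no stub is closed, nothing here is a statement about the Navier–Stokes equations.
-/

-- the sub-problem namespace repeats the summit name by design (D-0017)
set_option linter.dupNamespace false

namespace Summit.NavierStokesRegularity.NavierStokesRegularity.Theorems

open Set Filter Topology Literature.Analysis.FluidPDE Literature.Analysis.FluidPDE.TaoCascade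
open Summit.NavierStokesRegularity.NavierStokesRegularity.Theorems.TaylorModelCert

namespace CertificateGlueOn

variable {m : ℕ} {𝕊 : Finset (ℤ × ℤ × ℤ)} {ε₀ : ℝ} {α : Fin m → Fin m → Fin m → ℤ × ℤ × ℤ → ℝ} {Kb Ka : ℤ}
  {Eb Et : ℝ} {M : ℤ → ℝ}

/-- **`StepRead` FROM THE SECTION NODE, VECTOR REMAINDER**: glue XXXI `stepRead_of_sectionNode` with the node `PInParaV x̄ C r E` and `secErr`
taken with the remainder vector `E`. [cite: Zgliczynski2002C1Lohner, §3–4 (Lohner-type parallelepiped sets; section maps); cell certificate format, section readout, vector remainder] -/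
theorem stepRead_of_sectionNodeV (hKb : 0 ≤ Kb) (hKa : 1 ≤ Ka) {ω : Fin m → ℤ → ℝ} (hω : ∀ i k, 0 < ω i k)
    {t : ℕ → ℝ} {Node Hull : ℕ → (Fin m → ℤ → ℝ) → Prop} {j : ℕ}
    {xb r E : Fin (m * winLen Kb Ka) → ℝ} {C : Matrix (Fin (m * winLen Kb Ka)) (Fin (m * winLen Kb Ka)) ℝ}
    {lo hi dlo dhi : Fin m → ℤ → ℝ} {q p f κ Φ W : Fin (m * winLen Kb Ka) → ℝ} {Δ lev : ℝ}
    (hstep : StepCert 𝕊 ε₀ α Kb Ka Eb Et M t Node Hull j)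
    (hN : ∀ y, Node j y → PInParaV Kb Ka ω xb C r E y) (hHB : ∀ y, Hull j y → InBoxOn Kb Ka lo hi y)
    (hrange : FieldRangeOn 𝕊 ε₀ α Kb Ka Eb Et lo hi dlo dhi) (hΔ : t (j + 1) - t j ≤ Δ)
    (hd : 0 < secD q p f) (hκ : ∀ c, |f c| ≤ κ c * secD q p f)
    (hF : ∀ c, pxcoord Kb Ka ω dlo c ≤ pxcoord Kb Ka ω dhi c)
    (hΦ : ∀ c, pxcoord Kb Ka ω dhi c - f c ≤ Φ c ∧ f c - pxcoord Kb Ka ω dlo c ≤ Φ c)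
    (hW : ∀ y, InBoxOn Kb Ka lo hi y → ∀ c, |pxcoord Kb Ka ω y c - p c| ≤ W c) :
    StepRead 𝕊 ε₀ α Kb Ka Eb Et M t Node (fun y => secQ q (pxcoord Kb Ka ω y) = lev →
      ∀ c, |pxcoord Kb Ka ω y c - secCentre q p f xb lev c| ≤
        ∑ col, |secFrame q p f C c col| * r col + secErr q p κ E Φ Δ (secQmax q W) c) j := by
  intro s S hs0 hs1 hnode hrun hM hsec c
  have hKK : 0 ≤ Ka + Kb + 1 := by omega
  have hin : ∀ u ∈ Icc 0 s, InBoxOn Kb Ka lo hi (slice S u) :=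
    fun u hu => hHB _ ((hstep s S hs0 hs1 hnode hrun hM).1 u hu)
  have hpl := picard_level hrun hrange hin
  obtain ⟨ξ, e, hξ, he, hx0⟩ := hN _ hnode
  have hδ : ∀ d, s * pxcoord Kb Ka ω dlo d ≤ pxcoord Kb Ka ω (slice S s) d - pxcoord Kb Ka ω (slice S 0) d ∧
      pxcoord Kb Ka ω (slice S s) d - pxcoord Kb Ka ω (slice S 0) d ≤ s * pxcoord Kb Ka ω dhi d := by
    intro d
    obtain ⟨hk1, hk2⟩ := shellAt_mem hKK (finProdFinEquiv.symm d).2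
    have h := hpl (finProdFinEquiv.symm d).1 (shellAt Kb (finProdFinEquiv.symm d).2) hk1 hk2 s ⟨hs0.le, le_rfl⟩
    have hωp := hω (finProdFinEquiv.symm d).1 (shellAt Kb (finProdFinEquiv.symm d).2)
    simp only [pxcoord, pwcoord, slice_apply]
    rw [← sub_div, mul_div_assoc', mul_div_assoc']
    exact ⟨div_le_div_of_nonneg_right h.1 hωp.le, div_le_div_of_nonneg_right h.2 hωp.le⟩
  exact sectionNode_box (E := E) hd hκ hx0 hξ he ⟨hs0.le, hs1.trans hΔ⟩ hδ hF hΦ hsec (hW _ (hin s ⟨hs0.le, le_rfl⟩)) c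

/-- **`StepRead` INTO THE SECTION-NODE BOX FROM THE BOOLEANS, VECTOR LAYOUT**: `checkGlobal`, `checkStepV … j` (glue XXIX-c) and `checkSection`
(glue XXXIII, against the record's box and input defect) ⇒ every run from `nodeOfV rec j` of length `≤ h j`, read where `sec_q(pxcoord y) = lev`, has
`|pxcoord y − x*|_c ≤ Σ_col |C*_{c,col}| r_col + E*_c` with `E*` built from the remainder VECTOR `(rec j).E`.
[cite: Zgliczynski2002C1Lohner, §3–4 (Lohner-type parallelepiped sets; section maps); cell certificate format, section checker, vector remainder] -/
theorem stepRead_of_checksV (hKb : 0 ≤ Kb) (hKa : 1 ≤ Ka) {shifts : List (ℤ × ℤ × ℤ)} (hnd : shifts.Nodup)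
    (h𝕊 : IsNearestNeighbourSet shifts.toFinset) {q : ℚ}
    {αq : Fin m → Fin m → Fin m → ℤ × ℤ × ℤ → ℚ} {ωq : Fin m → ℤ → ℚ} (hω : ∀ i k, 0 < ωq i k)
    {prec p kexp nexp : ℕ} {Sp Sm : IntervalD} {bD : Dyad} {Eb Et lev : ℚ} {M : ℤ → ℝ} {rec : ℕ → VRec}
    {qz : Array ℤ} {sr : SecRec} {j : ℕ}
    (hg : checkGlobal m Kb Ka prec shifts αq ωq q Sp Sm bD = true)
    (hs : checkStepV m Kb Ka prec p kexp nexp shifts αq ωq Sp Sm bD Eb Et rec j = true)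
    (hsec : checkSection m Kb Ka prec shifts (coefBoxOf prec αq ωq Sp Sm) qz (rec j).lo (rec j).hi (rec j).δ sr = true) :
    let n := m * winLen Kb Ka
    let ω : Fin m → ℤ → ℝ := fun i k => (ωq i k : ℝ)
    StepRead shifts.toFinset (q : ℝ) (fun i₁ i₂ i μ => (αq i₁ i₂ i μ : ℝ)) Kb Ka (Eb : ℝ) (Et : ℝ) M (tOfV rec) (nodeOfV Kb Ka ωq rec)
      (fun y => secQ (qvec (n := n) qz) (pxcoord Kb Ka ω y) = (lev : ℝ) →
        ∀ c, |pxcoord Kb Ka ω y c - secCentre (qvec (n := n) qz) (dvec (n := n) sr.p) (dvec (n := n) sr.f)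
            (dvec (n := n) (rec j).x) (lev : ℝ) c| ≤
          ∑ col, |secFrame (qvec (n := n) qz) (dvec (n := n) sr.p) (dvec (n := n) sr.f) (dmat (n := n) (rec j).C) c col| *
              dvec (n := n) (rec j).r col +
            secErr (qvec (n := n) qz) (dvec (n := n) sr.p) (dvec (n := n) sr.κ) (dvec (n := n) (rec j).E) (dvec (n := n) sr.Φ)
              ((rec j).h : ℝ) (secQmax (qvec (n := n) qz) (dvec (n := n) sr.W)) c) j := by
  intro n ω
  have hg' := hg
  simp only [checkGlobal, Bool.and_eq_true, decide_eq_true_eq, Dyad.ble_iff, Dyad.toReal_ofInt, Int.cast_zero] at hg'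
  obtain ⟨⟨⟨⟨hSp, hSm⟩, hq⟩, -⟩, -⟩ := hg'
  have hs' := hs
  simp only [checkStepV, Bool.and_eq_true, decide_eq_true_eq, Dyad.ble_iff, Dyad.toReal_ofInt, Int.cast_zero] at hs'
  obtain ⟨⟨⟨⟨⟨⟨⟨⟨⟨⟨⟨⟨⟨⟨-, -⟩, hAA'⟩, -⟩, -⟩, -⟩, -⟩, -⟩, -⟩, -⟩, -⟩, h13⟩, -⟩, h11⟩, -⟩ := hs'
  have hq' : 0 < 1 + (q : ℝ) := by
    have : ((-1 : ℚ) : ℝ) < (q : ℝ) := by exact_mod_cast hq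
    push_cast at this; linarith
  have hω' : ∀ i k, (0 : ℝ) < ω i k := fun i k => show (0 : ℝ) < (ωq i k : ℝ) by exact_mod_cast hω i k
  have hcoef := coefBoxOK_coefBoxOf (Kb := Kb) (Ka := Ka) prec hq' αq ωq hSp hSm shifts
  have hstep := stepCert_of_checkStepV (M := M) hKb hKa hnd h𝕊 hω hg hs
  have hdef := pinputDefect_of_checkDefectT prec hnd h𝕊 hq' hω hSp hSm h11
  have hrange := fieldRangeOn_of_pqBox (Eb := (Eb : ℝ)) (Et := (Et : ℝ)) hKb hKa hω' hnd hcoef prec hdef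
  obtain ⟨hd, hκ, hF, hΦ, hW⟩ := section_hyps_of_check (prec := prec) (shifts := shifts) (coefB := coefBoxOf prec αq ωq Sp Sm) hKb hKa hω hsec
  exact stepRead_of_sectionNodeV hKb hKa hω' hstep (fun y hy => hy) (fun y hy => inBox_of_hullOfV hnd hω hAA'.le h13 hy) hrange
    (tOfV_succ_sub rec j).le hd hκ hF hΦ hW

end CertificateGlueOn

end Summit.NavierStokesRegularity.NavierStokesRegularity.Theorems
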